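import Summits.QuantumFields.BalabanUV.T4Continuum.Support.B13OpDatumJunctions
import Summits.QuantumFields.BalabanUV.T4Continuum.Support.B13HistInsertion
import Summits.QuantumFields.BalabanUV.T4Continuum.Support.B13StepTermFamily
import Summits.QuantumFields.BalabanUV.T4Continuum.Support.B13Base
import Summits.QuantumFields.BalabanUV.T4Continuum.Support.B13BaseInsDatum
import Summits.QuantumFields.BalabanUV.T4Continuum.Support.TermRepOfSeries

/-!
# NE5 ∕ U3 — row O1-e REPRESENTATION: the step model ASSEMBLED from rows O1-b∕c∕d∕f, its two runs' outputs DEFINED by the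
# renormalisation-group recursion, and leaves L01∕L02 (`RepresentsA`∕`RepresentsB`) + L03 (`InBase`) BY CONSTRUCTION
# (claim table `t4/b2b-balaban-t4-ne5-p1/O1-CLAIM-TABLE-NE5-P1.md` row O1-e; design `B13StepDesign.md` v0.2 RULES R1–R6)

Cell `pub-balaban`, unit `b2b-balaban-t4-ne5-formalise-leaf-09` (NE5 formalisation swarm, LEAF PROVER 09; journal CLAIM O1-e
`CLAIMS.log` l.5844, 2026-08-20T06:01Z).  Summits-side new work under the LEAN PLACEMENT RULE (cell modelling + bookkeeping;
NOT a Literature module).  HONEST FRAMING: rung (B)+1 of the FINITE-VOLUME T⁴ continuum programme — NOT infinite volume, NOT a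
mass gap, NOT the Clay problem, NOT a proof of NE5 (NOT PRINTED in [Balaban1987RG1]–[Balaban1989LargeFieldII]; they print
ε-UNIFORM bounds, never η-RATES).  HONEST DEPENDENCY (cell line, verbatim): continuum YM on T⁴ ⇐ BetaPertH ∧ nine spine
estimates (0/9 proved); BetaPertH ⇐ (D1) ∧ (D4) ∧ CAP+tail; G-an2-4 gates asym, D1 and NE2/3/4.

WHAT THIS FILE DOES.  The swarm's rows typed the SLOTS of one step of [Balaban1988RG2Cluster] §2 as a
`T4InputCauchyRateData.StepModel` (design RULE R1: ONE output functional for both runs, the lattice spacing only in the DATA):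
O1-b the operator datum `Op := B13OpDatum.OpDatum E` with data maps `B13OpDatumJunctions.opOf F raw` (p207653∕p207906), O1-c
the inserted history and the age-weighted insertion class `B13HistInsertion.InsDatum` (p207748∕…), O1-d the Ursell term family
`B13StepTermFamily.term 𝒯 inc act` with output `out := ∑'` (p207773∕p207797; d3 `TermRepOfSeries` p207636), O1-f the budget-box
base `B13Base` (p207657).  Every row left Bałaban's actual objects as NAMED PARAMETERS (raw species suppliers, insertion-operator
data, the (2.14)-activity terms `act`, the indexing) — so the assembled model is a FUNCTION of a parameter record, GENERIC IN
THE CARRIERS `C` (the concrete `T4OutputRate.Carriers` instance is row O1-a, ruled by the owner; it plugs in as one argument):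
* §1 `Assembly C E IOp Hist ι P J` (DATA, no inequality inside) and `Assembly.step 𝔄 BHist : StepModel C (OpDatum E) Hist` —
  `Out := out 𝒯 inc act`, `opA := opOf F (rawA read AT THE TRANSPORTED background)`, `opB := opOf F rawB`, `insA∕insB :=
  D.insA∕D.insB`, base := the SELF-CENTRED budget box `ballClass (selfCtr · histRef) 0 BHist` (O1-f's dictionary: operator
  budget `0` about run B's own operators, history budget `BHist` about the base part `D.base k (D.insOpB g U k)`), margins =
  MODEL PARAMETERS (RULE R6);
* §2 THE TWO RUNS' OUTPUTS DEFINED BY THE RECURSION (RULE R1 = (2.13) itself): `outA := StepRecursion.recA`, `outB := recB`, and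
  **`representsB`** (L02, on EVERY window — no hypothesis), **`representsA`** (L01, under the one READING `TransportReads`: run
  A's insertion-operator data depend on the run-B background only through `C.transport` — by `rfl` when O1-c defines them at
  the transported background, `transportReads_of_insOpAt`), uniqueness (`eq_outB`, `eq_outA`), the structure binders
  `InsAffine`∕`InsBlind`∕`InsHomog`∕`InsBlindB` and the readings `ReadsA`∕`ReadsB`∕`ReadsIns`∕`ReadsTransported` — all from the
  rows' lemmas BY NAME (`StepRecursion.representsA_recA`∕`representsB_recB`, `InsDatum.insBlind_of_readsA`∕`insBlindB_of_readsB`∕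
  `insA_eq_of_transport_eq`∕`readsIns_of_reads`);
* §3 LEAF L03 for the assembled model from DISPLAYED ONE-RUN inputs: the run-B twin `SliceBudgetB` of O1-c's age-free W3 binder
  (NOT PRINTED as a statement about arbitrary single-scale tables — printed KIND: the `j`-th term of [II] (1.24) p. 7 ∕ (1.29)
  p. 8 ∕ (1.36) p. 9 at the inductive level), the quoted one-run level `DecayBound EB W E₀ κ` (leaf L06, [Balaban1987RG1] (1.18)
  p. 263 — a hypothesis SHAPE, c4) and signs ⟹ `HistBudgetB` with `BHist k = E₀·rHist k·c∕(1 − ω)` (the (1.36) mechanism: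
  scale-by-scale slices, the age sum `Σ_{j<k} ω^{k−1−j} ≤ 1∕(1 − ω)`), hence **`inBase`** (`B13Base.inBase_of_budgets` with
  `opBudgetB_selfCtr`), `baseBudget`, `boxInClass` (room ⟹ slack);
* §4 the junctions the END faces read, for the assembled model, BY NAME: W1 `operatorRate_of_weightedEntrywise` (O1-b's
  `operatorRate_of_weightedEntrywise_floor`; its input `WeightedEntrywiseRate` is row NE2's object in entry currency, DISPLAYED),
  W3 `insScaleBoundLevel`∕`insScaleBound` (O1-c's `insScaleBoundLevel_of_sliceBudget`), the identification `out_eq_seriesOut` and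
  **`termRep`** (d3-ii: `TermRep` on any class from the displayed termwise majorant — `TermRepOfSeries.termRep_of_out_eq_seriesOut`).
WHAT IS *NOT* HERE (honest).  No estimate: W2 (class bound ∕ line analyticity of the (2.14)-terms — wall O2, GAPS G-ne5p1-1′),
the entrywise two-run rate of the species (row NE2), the slice budgets (W3 level, O3), the one-run levels L05∕L06 and the
numerics stay DISPLAYED binders of the END faces; the concrete carriers (O1-a) and the identification of the parameters with
[II]'s kernels∕potentials∕terms (O4-r readings; the instancer) are not in this file.  Nothing of the manuscripts under audit is
asserted; they are cited for KIND∕locus only.  `FlowStep.BetaPertH`, (B), (B^μ) do not occur.  0 sorry; no new axioms.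
-/

noncomputable section

open scoped BigOperators
open Metric Set Finset

namespace Summit.QuantumFields.BalabanUV.T4Continuum.B13Represents

open Literature.MathematicalPhysics.QuantumFieldTheory.Balaban1983to89.T4OutputRate (Carriers Functional DecayBound)
open Literature.MathematicalPhysics.QuantumFieldTheory.Balaban1983to89.T4InputCauchyRateData (StepModel tableA tableB sliceAt)
open Literature.MathematicalPhysics.QuantumFieldTheory.Balaban1983to89.T4InputCauchyRateSpecies
  (ballClass BaseBudget BoxInClass)
open Literature.MathematicalPhysics.QuantumFieldTheory.Balaban1983to89.T4InputCauchyRateTermwise (TermRep TermBound)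
open Summit.QuantumFields.BalabanUV.T4Continuum.B13OpDatum (Format OpDatum)
open Summit.QuantumFields.BalabanUV.T4Continuum.B13OpDatumJunctions
  (opOf RawBounded WeightedEntrywiseRate operatorRate_of_weightedEntrywise_floor)
open Summit.QuantumFields.BalabanUV.T4Continuum.B13HistInsertion (InsDatum)
open Summit.QuantumFields.BalabanUV.T4Continuum.B13StepTermFamily (TermIndexing term out)
open Summit.QuantumFields.BalabanUV.T4Continuum.B13Base
  (HasBudgetBase OpBudgetB HistBudgetB selfCtr hasBudgetBase_withBase opBudgetB_selfCtr inBase_of_budgets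
    baseBudget_of_hasBudgetBase boxInClass_of_hasBudgetBase sum_pow_age_pred_le)
open Summit.QuantumFields.BalabanUV.T4Continuum.StepRecursion
  (InsBlindB ReadsTransported recA recB representsA_recA representsB_recB eq_recA_of_representsA eq_recB_of_representsB)
open Summit.QuantumFields.BalabanUV.T4Continuum.TermRepOfSeries (seriesOut OutIsSeries termRep_of_out_eq_seriesOut)
open Summit.QuantumFields.BalabanUV.T4Continuum.OutputRateInsertion (InsOpModel)

/-! ## §1 The assembly record and the assembled step model -/

/-- [folklore] DATA (no inequality inside): the PARAMETER RECORD of the assembled step — O1-d's term indexing `𝒯`, hard core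
`inc` and (2.14)-activity terms `act` (the resummed terms of `H(Z)`: NAMED PARAMETERS); O1-b's per-step formats `F` and the two
runs' RAW species suppliers, run A's on RUN-A backgrounds (read at `C.transport U` by the model — RULE R4); O1-c's insertion
datum `D` (both runs' insertion-operator data inside); the margins `rOp`, `rHist` (MODEL PARAMETERS, RULE R6). -/
structure Assembly (C : Carriers) (E IOp Hist ι P J : Type*) [NormedAddCommGroup Hist] [NormedSpace ℂ Hist] where
  /-- term indexing (row O1-d1) -/
  𝒯 : TermIndexing C ι P J
  /-- hard-core incompatibility of polymers ((2.11) ζ = 0) -/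
  inc : P → P → Prop
  /-- its decidability -/
  decInc : DecidableRel inc
  /-- the (2.14)-activity terms, read at the two-species input (row O1-d2's slot) -/
  act : P → J → OpDatum E → Hist → ℂ
  /-- per-step entry formats of the operator datum (row O1-b) -/
  F : ℕ → Format E
  /-- run A's raw species at a RUN-A background -/
  rawA : (ℕ → ℝ) → C.BgA → ℕ → E → ℂ
  /-- run B's raw species -/
  rawB : (ℕ → ℝ) → C.BgB → ℕ → E → ℂ
  /-- the insertion datum (row O1-c) -/
  D : InsDatum C IOp Hist
  /-- operator margin -/
  rOp : ℕ → ℝ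
  /-- history margin -/
  rHist : ℕ → ℝ
  rOp_pos : ∀ k, 0 < rOp k
  rHist_pos : ∀ k, 0 < rHist k

namespace Assembly

variable {C : Carriers} {E IOp Hist ι P J : Type*} [NormedAddCommGroup Hist] [NormedSpace ℂ Hist]
  (𝔄 : Assembly C E IOp Hist ι P J)

/-- [folklore] The hard core is decidable (field `decInc`). -/
instance instDecidableRelInc : DecidableRel 𝔄.inc := 𝔄.decInc

/-- [folklore] Run A's raw species READ AT THE TRANSPORTED BACKGROUND (how the carriers pair the runs, RULE R4). -/
def rawAt : (ℕ → ℝ) → C.BgB → ℕ → E → ℂ := fun g U k => 𝔄.rawA g (C.transport U) k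

/-- [folklore] The history reference of the class centre: the base part of the inserted history at run B's insertion-operator
datum (the table-independent `𝐏^{(k)}`-potentials of [II] (1.41), KIND). -/
def histRef : (ℕ → ℝ) → C.BgB → ℕ → Hist := fun g U k => 𝔄.D.base k (𝔄.D.insOpB g U k)

/-- [folklore] The RAW step model of the assembly (placeholder base `univ`, replaced in `step`): ONE output functional
`out 𝒯 inc act` for both runs (RULE R1), the two runs' operator data and insertions from rows O1-b∕O1-c. -/
def raw : StepModel C (OpDatum E) Hist where
  Out := out 𝔄.𝒯 𝔄.inc 𝔄.act
  opA := opOf 𝔄.F 𝔄.rawAt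
  opB := opOf 𝔄.F 𝔄.rawB
  insA := 𝔄.D.insA
  insB := 𝔄.D.insB
  Base := fun _ _ _ => Set.univ
  rOp := 𝔄.rOp
  rHist := 𝔄.rHist
  rOp_pos := 𝔄.rOp_pos
  rHist_pos := 𝔄.rHist_pos

/-- [folklore] **THE ASSEMBLED STEP MODEL** with the SELF-CENTRED BUDGET BOX of history radius `BHist` as admissible base
(row O1-f's dictionary `B13Base.selfCtr`∕`ballClass`: `Base k g U = B̄(opB g U k, 0) × B̄(histRef g U k, BHist k)`). -/
def step (BHist : ℕ → ℝ) : StepModel C (OpDatum E) Hist :=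
  𝔄.raw.withBase (ballClass (selfCtr 𝔄.raw 𝔄.histRef) 0 BHist)

variable (BHist : ℕ → ℝ)

/-- [folklore] The fields of the assembled model (all `rfl`). -/
@[simp] theorem step_Out : (𝔄.step BHist).Out = out 𝔄.𝒯 𝔄.inc 𝔄.act := rfl
/-- [folklore] -/ @[simp] theorem step_opA : (𝔄.step BHist).opA = opOf 𝔄.F 𝔄.rawAt := rfl
/-- [folklore] -/ @[simp] theorem step_opB : (𝔄.step BHist).opB = opOf 𝔄.F 𝔄.rawB := rfl
/-- [folklore] -/ @[simp] theorem step_insA : (𝔄.step BHist).insA = 𝔄.D.insA := rfl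
/-- [folklore] -/ @[simp] theorem step_insB : (𝔄.step BHist).insB = 𝔄.D.insB := rfl
/-- [folklore] -/ @[simp] theorem step_rOp : (𝔄.step BHist).rOp = 𝔄.rOp := rfl
/-- [folklore] -/ @[simp] theorem step_rHist : (𝔄.step BHist).rHist = 𝔄.rHist := rfl
/-- [folklore] -/
theorem step_base (k : ℕ) (g : ℕ → ℝ) (U : C.BgB) : (𝔄.step BHist).Base k g U =
    closedBall (opOf 𝔄.F 𝔄.rawB g U k) 0 ×ˢ closedBall (𝔄.histRef g U k) (BHist k) := rfl

/-- [folklore] The assembled model HAS the budget-box base about the self-centred centre (O1-f's `HasBudgetBase`, on the nose). -/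
theorem hasBudgetBase : HasBudgetBase (𝔄.step BHist) (selfCtr 𝔄.raw 𝔄.histRef) 0 BHist := fun _ _ _ => rfl

/-- [folklore] The centre of the installed base IS the assembled model's own run-B operators with the history reference. -/
theorem selfCtr_step : selfCtr (𝔄.step BHist) 𝔄.histRef = selfCtr 𝔄.raw 𝔄.histRef := rfl

/-! ## §2 The two runs' outputs DEFINED by the recursion; L01 ∕ L02 by construction; readings and structure binders -/

/-- [folklore] **RUN A's OUTPUT** `E_A^{(k)}(X; g, V)` of the assembled step: the recursively defined functional
`StepRecursion.recA` (RULE R1: E^{(k)} is DEFINED through `Out` by the recursion in the scale — [II] (2.13) p. 14 read as a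
definition; nothing printed is asserted). -/
def outA : Functional C C.BgA := recA (𝔄.step BHist)

/-- [folklore] **RUN B's OUTPUT** of the assembled step: `StepRecursion.recB`. -/
def outB : Functional C C.BgB := recB (𝔄.step BHist)

/-- [folklore] READING: run A's insertion of the assembled model IS the datum's (`rfl`). -/
theorem readsA (W : Set (ℕ → ℝ)) : 𝔄.D.ReadsA (𝔄.step BHist) W := fun _ _ _ _ _ => rfl

/-- [folklore] READING: run B's insertion of the assembled model IS the datum's (`rfl`). -/
theorem readsB (W : Set (ℕ → ℝ)) : 𝔄.D.ReadsB (𝔄.step BHist) W := fun _ _ _ _ _ => rfl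

/-- [folklore] The three run-A structure binders of the END faces, BY CONSTRUCTION (row O1-c's lemmas by name). -/
theorem insAffine (W : Set (ℕ → ℝ)) : (𝔄.step BHist).InsAffine W := InsDatum.insAffine_of_readsA (𝔄.readsA BHist W)
/-- [folklore] -/
theorem insBlind (W : Set (ℕ → ℝ)) : (𝔄.step BHist).InsBlind W := InsDatum.insBlind_of_readsA (𝔄.readsA BHist W)
/-- [folklore] -/
theorem insHomog (W : Set (ℕ → ℝ)) : (𝔄.step BHist).InsHomog W := InsDatum.insHomog_of_readsA (𝔄.readsA BHist W)
/-- [folklore] The run-B twin (what `StepRecursion.representsB_recB` consumes). -/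
theorem insBlindB (W : Set (ℕ → ℝ)) : InsBlindB (𝔄.step BHist) W := InsDatum.insBlindB_of_readsB (𝔄.readsB BHist W)

/-- [folklore] **L02 BY CONSTRUCTION, ON EVERY WINDOW**: the recursively defined run-B output satisfies `RepresentsB`. -/
theorem representsB (W : Set (ℕ → ℝ)) : (𝔄.step BHist).RepresentsB (𝔄.outB BHist) W :=
  representsB_recB (𝔄.insBlindB BHist W)

/-- [folklore] **L02 IS DEFINITIONAL**: any run-B functional satisfying `RepresentsB` for the assembled model agrees with `outB`
on the window. -/
theorem eq_outB {W : Set (ℕ → ℝ)} {EB : Functional C C.BgB} (hEB : (𝔄.step BHist).RepresentsB EB W) {g : ℕ → ℝ}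
    (hg : g ∈ W) (U : C.BgB) (X : C.Dom) : EB g U X = 𝔄.outB BHist g U X :=
  eq_recB_of_representsB (𝔄.insBlindB BHist W) hEB hg U X

/-- [folklore] HYPOTHESIS SHAPE (a READING — how the carriers pair the runs; no estimate): run A's insertion-operator data
depend on the run-B background only through the transported background. -/
def TransportReads (W : Set (ℕ → ℝ)) : Prop :=
  ∀ g ∈ W, ∀ U U' : C.BgB, C.transport U = C.transport U' → ∀ k, 𝔄.D.insOpA g U k = 𝔄.D.insOpA g U' k

/-- [folklore] The reading holds BY `rfl`-REWRITING when the insertion-operator data are DEFINED at the transported background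
(the form row O1-c's instantiation takes, RULE R4 ∕ Q3). -/
theorem transportReads_of_insOpAt {insOpA' : (ℕ → ℝ) → C.BgA → ℕ → IOp}
    (h : ∀ g U k, 𝔄.D.insOpA g U k = insOpA' g (C.transport U) k) (W : Set (ℕ → ℝ)) : 𝔄.TransportReads W :=
  fun g _ U U' hUU' k => by rw [h, h, hUU']

/-- [folklore] `StepRecursion.ReadsTransported` for the assembled model: the operator half BY CONSTRUCTION (`rawAt`), the
insertion half from the reading (O1-c's `insA_eq_of_transport_eq`). -/
theorem readsTransported {W : Set (ℕ → ℝ)} (hT : 𝔄.TransportReads W) : ReadsTransported (𝔄.step BHist) W := by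
  intro g hg U U' hUU'
  refine ⟨fun k => ?_, fun k t => InsDatum.insA_eq_of_transport_eq (𝔄.readsA BHist W) hT hg hUU' k t⟩
  change opOf 𝔄.F 𝔄.rawAt g U k = opOf 𝔄.F 𝔄.rawAt g U' k
  simp only [B13OpDatumJunctions.opOf_apply, rawAt, hUU']

/-- [folklore] **L01 BY CONSTRUCTION**: under the transport reading, the recursively defined run-A output satisfies
`RepresentsA`. -/
theorem representsA {W : Set (ℕ → ℝ)} (hT : 𝔄.TransportReads W) : (𝔄.step BHist).RepresentsA (𝔄.outA BHist) W :=
  representsA_recA (𝔄.insBlind BHist W) (𝔄.readsTransported BHist hT)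

/-- [folklore] **L01 IS DEFINITIONAL**: any run-A functional satisfying `RepresentsA` agrees with `outA` at every transported
background on the window. -/
theorem eq_outA {W : Set (ℕ → ℝ)} (hT : 𝔄.TransportReads W) {EA : Functional C C.BgA}
    (hEA : (𝔄.step BHist).RepresentsA EA W) {g : ℕ → ℝ} (hg : g ∈ W) (U : C.BgB) (X : C.Dom) :
    EA g (C.transport U) X = 𝔄.outA BHist g (C.transport U) X :=
  eq_recA_of_representsA (𝔄.insBlind BHist W) (𝔄.readsTransported BHist hT) hEA hg U X

/-- [folklore] **MI-R (L01 ∧ L02) for the assembled step**, in one line. -/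
theorem represents {W : Set (ℕ → ℝ)} (hT : 𝔄.TransportReads W) :
    (𝔄.step BHist).RepresentsA (𝔄.outA BHist) W ∧ (𝔄.step BHist).RepresentsB (𝔄.outB BHist) W :=
  ⟨𝔄.representsA BHist hT, 𝔄.representsB BHist W⟩

/-- [folklore] `ReadsIns` (leaf L08r) BY CONSTRUCTION for the insertion-operator species of the datum (O1-c's `toInsOpModel`). -/
theorem readsIns [NormedAddCommGroup IOp] [NormedSpace ℂ IOp] (rI : ℕ → ℝ) (hrI : ∀ k, 0 < rI k) (W : Set (ℕ → ℝ)) :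
    (𝔄.D.toInsOpModel (𝔄.step BHist) rI hrI).ReadsIns W :=
  InsDatum.readsIns_of_reads (𝔄.readsA BHist W) (𝔄.readsB BHist W)

/-! ## §3 Leaf L03 for the assembled model from displayed one-run inputs (the (1.36) mechanism through the slices) -/

/-- [folklore] HYPOTHESIS SHAPE `SliceBudgetB κ c` — the RUN-B twin of row O1-c's age-free one-run W3 binder `InsDatum.SliceBudget`
(which is stated at run A's insertion-operator datum): a table supported on the scale `j < k` with entries `≤ T·e^{−κd}` is
inserted at step `k`, at RUN B's insertion-operator datum and before age weighting, with norm at most `c·T` history margins.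
NOT PRINTED as a statement about arbitrary single-scale tables — printed KIND: the `j`-th term of the one-run sums
[Balaban1988RG2Cluster] (1.24) p. 7 ∕ (1.29) p. 8 ∕ (1.36) p. 9 at the inductive level; displayed, asserted nowhere. -/
def SliceBudgetB (W : Set (ℕ → ℝ)) (κ c : ℝ) : Prop :=
  ∀ k, ∀ g ∈ W, ∀ (U : C.BgB) (j : ℕ) (T : ℝ) (t : C.Dom → ℝ), j < k → 0 ≤ T →
    (∀ Y, C.scale Y ≠ j → t Y = 0) → (∀ Y, C.scale Y = j → |t Y| ≤ T * Real.exp (-(κ * C.d Y))) →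
      ‖𝔄.D.slice k j (𝔄.D.insOpB g U k) t‖ ≤ 𝔄.rHist k * (c * T)

variable {𝔄 BHist}

/-- [folklore] A slice reads only its own scale: `slice k j a t = slice k j a (sliceAt j t)`. -/
theorem slice_eq_slice_sliceAt (k j : ℕ) (a : IOp) (t : C.Dom → ℝ) :
    𝔄.D.slice k j a t = 𝔄.D.slice k j a (sliceAt j t) :=
  𝔄.D.slice_local k j a t (sliceAt j t) fun _ hY =>
    (Literature.MathematicalPhysics.QuantumFieldTheory.Balaban1983to89.T4InputCauchyRateData.sliceAt_apply_of_eq hY).symm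

/-- [folklore] **THE (1.36) MECHANISM for the insertion datum**: a table of one-run level `E₀·e^{−κd}` BELOW scale `k` is inserted at
step `k` (run B's datum) within `E₀·rHist k·c·Σ_{j<k} ω^{k−1−j} ≤ E₀·rHist k·c∕(1 − ω)` of the base part — scale by scale through
the slices (`SliceBudgetB`), then the geometric age sum. -/
theorem norm_insB_sub_base_le {W : Set (ℕ → ℝ)} {κ c E₀ : ℝ} (hb : 𝔄.SliceBudgetB W κ c) (hE₀ : 0 ≤ E₀) (hc : 0 ≤ c)
    (hω : 0 ≤ 𝔄.D.ω) (hω1 : 𝔄.D.ω < 1) {k : ℕ} {g : ℕ → ℝ} (hg : g ∈ W) (U : C.BgB) {t : C.Dom → ℝ}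
    (ht : ∀ Y, C.scale Y < k → |t Y| ≤ E₀ * Real.exp (-(κ * C.d Y))) :
    ‖𝔄.D.insB g U k t - 𝔄.histRef g U k‖ ≤ E₀ * (𝔄.rHist k * (c / (1 - 𝔄.D.ω))) := by
  have hsplit : 𝔄.D.insB g U k t - 𝔄.histRef g U k =
      ∑ j ∈ range k, ((𝔄.D.ω ^ (k - 1 - j) : ℝ) : ℂ) • 𝔄.D.slice k j (𝔄.D.insOpB g U k) t := by
    simp only [InsDatum.insB, InsDatum.ins, histRef, add_sub_cancel_left]
  rw [hsplit]
  have hterm : ∀ j ∈ range k,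
      ‖((𝔄.D.ω ^ (k - 1 - j) : ℝ) : ℂ) • 𝔄.D.slice k j (𝔄.D.insOpB g U k) t‖ ≤
        𝔄.D.ω ^ (k - 1 - j) * (𝔄.rHist k * (c * E₀)) := by
    intro j hj
    have hjk : j < k := mem_range.1 hj
    rw [norm_smul, Complex.norm_real, Real.norm_eq_abs, abs_of_nonneg (pow_nonneg hω _), slice_eq_slice_sliceAt]
    refine mul_le_mul_of_nonneg_left ?_ (pow_nonneg hω _)
    refine hb k g hg U j E₀ (sliceAt j t) hjk hE₀ (fun _ hY => ?_) (fun Y hY => ?_)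
    · exact Literature.MathematicalPhysics.QuantumFieldTheory.Balaban1983to89.T4InputCauchyRateData.sliceAt_apply_of_ne hY
    · rw [Literature.MathematicalPhysics.QuantumFieldTheory.Balaban1983to89.T4InputCauchyRateData.sliceAt_apply_of_eq hY]
      exact ht Y (hY ▸ hjk)
  calc ‖∑ j ∈ range k, ((𝔄.D.ω ^ (k - 1 - j) : ℝ) : ℂ) • 𝔄.D.slice k j (𝔄.D.insOpB g U k) t‖
      ≤ ∑ j ∈ range k, 𝔄.D.ω ^ (k - 1 - j) * (𝔄.rHist k * (c * E₀)) := norm_sum_le_of_le _ hterm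
    _ = (∑ j ∈ range k, 𝔄.D.ω ^ (k - 1 - j)) * (𝔄.rHist k * (c * E₀)) := by rw [sum_mul]
    _ ≤ 1 / (1 - 𝔄.D.ω) * (𝔄.rHist k * (c * E₀)) :=
        mul_le_mul_of_nonneg_right (sum_pow_age_pred_le hω hω1 k)
          (mul_nonneg (𝔄.rHist_pos k).le (mul_nonneg hc hE₀))
    _ = E₀ * (𝔄.rHist k * (c / (1 - 𝔄.D.ω))) := by ring

/-- [folklore] **RUN B's HISTORY BUDGET FROM THE PRINTED ONE-RUN LEVEL (leaf L06) THROUGH THE SLICES**: `SliceBudgetB κ c`, the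
quoted level `DecayBound EB W E₀ κ` and the signs give `HistBudgetB` about the self-centred centre with radius `E₀·rHist·c∕(1 − ω)`. -/
theorem histBudgetB {W : Set (ℕ → ℝ)} {κ c E₀ : ℝ} {EB : Functional C C.BgB} (hb : 𝔄.SliceBudgetB W κ c)
    (hdB : DecayBound EB W E₀ κ) (hE₀ : 0 ≤ E₀) (hc : 0 ≤ c) (hω : 0 ≤ 𝔄.D.ω) (hω1 : 𝔄.D.ω < 1) :
    HistBudgetB (𝔄.step BHist) EB W (selfCtr 𝔄.raw 𝔄.histRef) fun k => E₀ * (𝔄.rHist k * (c / (1 - 𝔄.D.ω))) := by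
  intro k g hg U
  change ‖𝔄.D.insB g U k (tableB EB g U) - 𝔄.histRef g U k‖ ≤ E₀ * (𝔄.rHist k * (c / (1 - 𝔄.D.ω)))
  exact norm_insB_sub_base_le hb hE₀ hc hω hω1 hg U fun Y _ => hdB g hg U Y

/-- [folklore] The history radius of record: `E₀·rHist k·c∕(1 − ω)`. -/
def bHist (𝔄 : Assembly C E IOp Hist ι P J) (E₀ c : ℝ) : ℕ → ℝ := fun k => E₀ * (𝔄.rHist k * (c / (1 - 𝔄.D.ω)))

/-- [folklore] **LEAF L03 FOR THE ASSEMBLED MODEL** with base radius `bHist E₀ c`: `SliceBudgetB κ c ∧ DecayBound EB W E₀ κ` (+ signs)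
⟹ `InBase EB W` — the operator clause is EMPTY (budget `0` about run B's own operators, `B13Base.opBudgetB_selfCtr`). -/
theorem inBase {W : Set (ℕ → ℝ)} {κ c E₀ : ℝ} {EB : Functional C C.BgB} (hb : 𝔄.SliceBudgetB W κ c)
    (hdB : DecayBound EB W E₀ κ) (hE₀ : 0 ≤ E₀) (hc : 0 ≤ c) (hω : 0 ≤ 𝔄.D.ω) (hω1 : 𝔄.D.ω < 1) :
    (𝔄.step (𝔄.bHist E₀ c)).InBase EB W :=
  inBase_of_budgets (𝔄.hasBudgetBase _) (opBudgetB_selfCtr _ _ W) (histBudgetB hb hdB hE₀ hc hω hω1)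

/-- [folklore] In particular L03 for the model's OWN run-B output `outB` (the functional the route is about). -/
theorem inBase_outB {W : Set (ℕ → ℝ)} {κ c E₀ : ℝ} (hb : 𝔄.SliceBudgetB W κ c)
    (hdB : DecayBound (𝔄.outB (𝔄.bHist E₀ c)) W E₀ κ) (hE₀ : 0 ≤ E₀) (hc : 0 ≤ c) (hω : 0 ≤ 𝔄.D.ω) (hω1 : 𝔄.D.ω < 1) :
    (𝔄.step (𝔄.bHist E₀ c)).InBase (𝔄.outB (𝔄.bHist E₀ c)) W :=
  inBase hb hdB hE₀ hc hω hω1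

/-- [folklore] `BaseBudget` of the budget∕secant END faces BY CONSTRUCTION (O1-f by name). -/
theorem baseBudget (BHist : ℕ → ℝ) (W : Set (ℕ → ℝ)) :
    BaseBudget (𝔄.step BHist) W (selfCtr 𝔄.raw 𝔄.histRef) 0 BHist :=
  baseBudget_of_hasBudgetBase (𝔄.hasBudgetBase BHist) W

/-- [folklore] ROOM ⟹ SLACK: class radii `ROp k ≥ rOp k` (operators: pure room about run B's own data) and
`RHist k ≥ BHist k + rHist k` put the two-margin box of every base point inside `ballClass (selfCtr …) ROp RHist` — the class
on which the wall O2 (`ClassBound`∕`TermBound`∕`TermLineAnalytic`) is to be DISPLAYED. -/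
theorem boxInClass (BHist : ℕ → ℝ) (W : Set (ℕ → ℝ)) {ROp RHist : ℕ → ℝ} (hOp : ∀ k, 𝔄.rOp k ≤ ROp k)
    (hHist : ∀ k, BHist k + 𝔄.rHist k ≤ RHist k) :
    BoxInClass (𝔄.step BHist) (ballClass (selfCtr 𝔄.raw 𝔄.histRef) ROp RHist) W :=
  boxInClass_of_hasBudgetBase (𝔄.hasBudgetBase BHist) W (fun k => by rw [Pi.zero_apply, zero_add]; exact hOp k) hHist

/-! ## §4 The junctions the END faces read, for the assembled model, BY NAME -/

/-- [folklore] **W1 (leaf L07) from row NE2's object in ENTRY CURRENCY** (O1-b's junction by name): bounded raw suppliers of both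
runs, a weighted entrywise two-run rate `c·θ^k` between run A's species AT THE TRANSPORTED BACKGROUND and run B's, and an
[I]-type margin floor `r₀ ≤ rOp k` ⟹ `OperatorRate W (c∕r₀) θ`.  The rate is DISPLAYED (NOT PRINTED; row NE2's residual). -/
theorem operatorRate_of_weightedEntrywise {W : Set (ℕ → ℝ)} {c θ r₀ : ℝ} (hA : RawBounded 𝔄.F 𝔄.rawAt W)
    (hB : RawBounded 𝔄.F 𝔄.rawB W) (h : WeightedEntrywiseRate 𝔄.F 𝔄.rawAt 𝔄.rawB W c fun k => θ ^ k) (hc : 0 ≤ c)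
    (hθ : 0 ≤ θ) (hfl : ∀ k, r₀ ≤ 𝔄.rOp k) (hr₀ : 0 < r₀) : (𝔄.step BHist).OperatorRate W (c / r₀) θ :=
  operatorRate_of_weightedEntrywise_floor (𝔄.step BHist) rfl rfl hA hB h hc hθ hfl hr₀

/-- [folklore] **W3 at every level (leaf L09) from row O1-c's age-free binder** (`insScaleBoundLevel_of_sliceBudget` by name). -/
theorem insScaleBoundLevel {W : Set (ℕ → ℝ)} {κ c : ℝ} (hb : 𝔄.D.SliceBudget (𝔄.step BHist) W κ c) (hω : 0 ≤ 𝔄.D.ω) :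
    (𝔄.step BHist).InsScaleBoundLevel W κ c 𝔄.D.ω :=
  InsDatum.insScaleBoundLevel_of_sliceBudget (𝔄.readsA BHist W) hb hω

/-- [folklore] … and at a reference level `E₁ ≥ 0` (the END faces' `InsScaleBound`). -/
theorem insScaleBound {W : Set (ℕ → ℝ)} {κ c E₁ : ℝ} (hb : 𝔄.D.SliceBudget (𝔄.step BHist) W κ c) (hω : 0 ≤ 𝔄.D.ω)
    (hE₁ : 0 ≤ E₁) : (𝔄.step BHist).InsScaleBound W κ E₁ c 𝔄.D.ω :=
  fun k g hg U t j hj hsupp hbd => insScaleBoundLevel hb hω k g hg U t j E₁ hj hE₁ hsupp hbd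

/-- [folklore] The output of the assembled model IS the series of its Ursell terms (d3's identification, `rfl`). -/
theorem out_eq_seriesOut : (𝔄.step BHist).Out = seriesOut (term 𝔄.𝒯 𝔄.inc 𝔄.act) := rfl

/-- [folklore] `OutIsSeries` for the assembled model. -/
theorem outIsSeries : OutIsSeries (𝔄.step BHist) (term 𝔄.𝒯 𝔄.inc 𝔄.act) := fun _ _ _ _ => rfl

/-- [folklore] **d3-ii — `TermRep` FOR THE ASSEMBLED MODEL on any class, from the DISPLAYED termwise majorant** (printed SUPPORT:
[II] Lemma 3 (2.38) p. 20, (2.41) p. 21 — locators only; the majorant is O2's data, asserted nowhere). -/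
theorem termRep {K : ℕ → (ℕ → ℝ) → C.BgB → Set (OpDatum E × Hist)} {W : Set (ℕ → ℝ)} {κ : ℝ} {a : ℕ → ι → ℝ}
    (hbd : TermBound K (term 𝔄.𝒯 𝔄.inc 𝔄.act) W κ a) (ha : ∀ k, Summable (a k)) :
    TermRep (𝔄.step BHist) K (term 𝔄.𝒯 𝔄.inc 𝔄.act) W :=
  termRep_of_out_eq_seriesOut out_eq_seriesOut hbd ha

/-! ## §5 (file v1.1, ADDITIVE) Junction with row O1-f part 2 (`B13BaseInsDatum`, p208169): the two routes to L03 AGREE ON THE NOSE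

Row O1-f's part 2 landed the (1.36) mechanism on row O1-c's `InsDatum` class (`SliceBudgetAt`, `insDatumBudgetBase`,
`inBase_baseBudget_of_insDatum`) minutes before §3 above (journal l.5963 vs l.6037).  Nothing is re-proved here: we record that
§3's displayed binder and base ARE leaf-03's BY `rfl`, and re-derive L03 ∧ `BaseBudget` for the assembled model from leaf-03's
theorem BY NAME (so either name may be cited; dedup = definitional agreement). -/

/-- [folklore] §3's run-B slice budget IS O1-f part 2's `SliceBudgetAt … D.insOpB` for the assembled model (definitionally). -/
theorem sliceBudgetB_iff_sliceBudgetAt (BHist : ℕ → ℝ) (W : Set (ℕ → ℝ)) (κ c : ℝ) :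
    𝔄.SliceBudgetB W κ c ↔ B13BaseInsDatum.SliceBudgetAt 𝔄.D (𝔄.step BHist) W κ c 𝔄.D.insOpB := Iff.rfl

/-- [folklore] §1's history reference IS O1-f part 2's `baseB` (definitionally). -/
theorem histRef_eq_baseB : 𝔄.histRef = B13BaseInsDatum.baseB 𝔄.D := rfl

/-- [folklore] The assembled model at the radius of record `bHist E₀ c` IS the raw model with O1-f part 2's
`insDatumBudgetBase raw D E₀ c` installed (definitionally). -/
theorem step_bHist_eq (E₀ c : ℝ) :
    𝔄.step (𝔄.bHist E₀ c) = 𝔄.raw.withBase (B13BaseInsDatum.insDatumBudgetBase 𝔄.raw 𝔄.D E₀ c) := rfl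

/-- [folklore] **L03 ∧ `BaseBudget` for the assembled model re-derived from O1-f part 2 BY NAME** (`inBase_baseBudget_of_insDatum`):
same displayed inputs as §3's `inBase` — the B-side slice budget, the quoted level `DecayBound EB W E₀ κ` (L06), signs. -/
theorem inBase_baseBudget_byName {W : Set (ℕ → ℝ)} {κ c E₀ : ℝ} {EB : Functional C C.BgB} (hb : 𝔄.SliceBudgetB W κ c)
    (hdB : DecayBound EB W E₀ κ) (hE₀ : 0 ≤ E₀) (hc : 0 ≤ c) (hω : 0 ≤ 𝔄.D.ω) (hω1 : 𝔄.D.ω < 1) :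
    (𝔄.step (𝔄.bHist E₀ c)).InBase EB W ∧
      BaseBudget (𝔄.step (𝔄.bHist E₀ c)) W (selfCtr 𝔄.raw (B13BaseInsDatum.baseB 𝔄.D)) 0
        fun k => E₀ * (𝔄.rHist k * (c / (1 - 𝔄.D.ω))) :=
  B13BaseInsDatum.inBase_baseBudget_of_insDatum (M := 𝔄.raw) (𝔄.readsB (𝔄.bHist E₀ c) W) hb hdB hE₀ hc hω hω1

end Assembly

end Summit.QuantumFields.BalabanUV.T4Continuum.B13Represents
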